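import Mathlib.MeasureTheory.Integral.IntervalIntegral.FundThmCalculus
import Literature.Analysis.FunctionSpaces.TorusSpaceTime
import Literature.Analysis.FunctionSpaces.TorusFluidGlueProofs
import Literature.Analysis.FunctionSpaces.TorusMollifierEstimates
import Literature.Analysis.FluidPDE.PassiveScalarClassicalWeak
import HarnessLib

/-!
# Discharged facts: mean conservation and the `L²` energy identity for classical passive scalars

`Literature.Analysis.FluidPDE.PassiveScalar` records as named facts the elementary balance laws of
classical (jointly smooth) solutions `θ` of the advection–diffusion equation
`∂ₜθ + u·∇θ = κΔθ`, `div u = 0`, on `S × T^d` (`Torus.IsClassicalScalarTransportOn S κ u θ`):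

* `IsClassicalScalarTransportOn.hasDerivWithinAt_scalarMean` — `d/dt ∫ θ(t) = 0`;
* `IsClassicalScalarTransportOn.hasDerivWithinAt_scalarL2Sq` — `d/dt ‖θ(t)‖²_{L²} = -2κ‖∇θ(t)‖²_{L²}`;
* `IsClassicalScalarTransportOn.hasDerivWithinAt_scalarVariance` — the same for the variance;
* `IsClassicalScalarTransportOn.scalarL2Sq_add_scalarDissipation` — the integrated form
  `‖θ(b)‖² + 2κ∫ₐᵇ‖∇θ‖² = ‖θ(a)‖²` on `[a, b] ⊆ S`

(DEIJ 2022, §1, (1.1)–(1.3); Evans 2010, §7.1.2 (b), proof of Thm. 2: multiply the equation by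
`θ`, integrate over the torus, integrate by parts). All four are proved here, along the printed
lines and exactly as the Navier–Stokes twin `Torus.IsClassicalNSSolutionOn.energy_balance_holds`
(`TorusFluidGlueProofs`): differentiation under `∫_{T^d}` within a convex time set
(`Torus.IsSmoothSpaceTimeOn.hasDerivWithinAt_integral`), the equation, and the two integrations by
parts on the torus — `∫ θ ⟪u, ∇θ⟫ = 0` for divergence-free `u`
(`Torus.integral_mul_inner_gradient_add_eq_zero`) and `∫ θ Δθ = -∫ ‖∇θ‖²`
(`Torus.integral_mul_laplacian_eq_neg_sum`). The integrated form first restricts the solution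
to the interval `[a, b]` (`IsClassicalScalarTransportOn.restrict`: one-sided time derivatives within
`S` and within `[a, b] ⊆ S` agree, `a < b`) and then applies the fundamental theorem of calculus,
the dissipation `t ↦ ‖∇θ(t)‖²_{L²}` being continuous (`IsClassicalScalarTransportOn.continuousOn_scalarGradNormSq`).
These identities are the "energy equality for `θ^m`" used throughout Cheskidov 2023, §4 and
Bruè–De Lellis 2023, §6.

## References

* T. D. Drivas, T. M. Elgindi, G. Iyer, I.-J. Jeong, *Anomalous dissipation in passive scalar
  transport*, Arch. Ration. Mech. Anal. 243 (2022), §1, (1.1)–(1.3). [DEIJ2022]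
* L. C. Evans, *Partial Differential Equations*, 2nd ed. (2010), §7.1.2, App. C.2. [Evans2010]
* A. Cheskidov, arXiv:2311.04182 (2023), §4 ("by the energy equality for `θ^m`"). [Cheskidov2023]
-/

open MeasureTheory Set Filter
open _root_.Topology
open scoped InnerProductSpace ContDiff ENNReal NNReal

noncomputable section

namespace Literature.Analysis.FluidPDE

namespace Torus

variable {d : Type*} [Fintype d] [DecidableEq d]

/-! ## Two integrations by parts for a single smooth slice -/

/-- `‖∇θ(x)‖² = ∑ᵢ (∂ᵢθ(x))²` for a `C¹` scalar on `T^d`. [folklore] -/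
theorem norm_gradient_sq_eq_sum {θ : UnitAddTorus d → ℝ} (hθ : FunctionSpaces.Torus.IsContDiff 1 θ)
    (x : UnitAddTorus d) :
    ‖FunctionSpaces.Torus.gradient θ x‖ ^ 2 = ∑ i, FunctionSpaces.Torus.partialDeriv i θ x ^ 2 := by
  rw [EuclideanSpace.norm_sq_eq]
  refine Finset.sum_congr rfl fun j _ => ?_
  rw [FunctionSpaces.Torus.gradient_apply hθ, Real.norm_eq_abs, sq_abs]

/-- `‖∇θ‖²_{L²} = ∑ᵢ ∫ (∂ᵢθ)²` for a smooth scalar on `T^d`. [folklore] -/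
theorem scalarGradNormSq_eq_sum_integral {θ : UnitAddTorus d → ℝ} (hθ : FunctionSpaces.Torus.IsSmooth θ) :
    scalarGradNormSq θ = ∑ i, ∫ x, FunctionSpaces.Torus.partialDeriv i θ x ^ 2 := by
  rw [scalarGradNormSq]
  simp_rw [norm_gradient_sq_eq_sum (hθ.isContDiff (by simp))]
  exact integral_finsetSum _ fun i _ => ((hθ.partialDeriv i).continuous.pow 2).integrable_unitAddTorus

/-- **Dissipativity of the Laplacian**: `∫ θ Δθ = -‖∇θ‖²_{L²}` for a smooth scalar on the torus
(Green's first identity with empty boundary; Evans 2010, App. C.2, Thm. 3 (i)). [cite: Evans2010, App. C.2 Thm. 3 (i)] -/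
theorem integral_mul_laplacian_self_eq_neg_scalarGradNormSq {θ : UnitAddTorus d → ℝ}
    (hθ : FunctionSpaces.Torus.IsSmooth θ) :
    ∫ x, θ x * FunctionSpaces.Torus.laplacian θ x = -scalarGradNormSq θ := by
  rw [FunctionSpaces.Torus.integral_mul_laplacian_eq_neg_sum hθ hθ, scalarGradNormSq_eq_sum_integral hθ]
  simp_rw [sq]

/-- **Incompressibility kills the transport term**: `∫ θ ⟪u, ∇θ⟫ = 0` for a smooth
divergence-free `u` and a smooth scalar `θ` (`θ ⟪u, ∇θ⟫ = ½ ⟪u, ∇θ²⟫`; Evans 2010, App. C.2,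
Thm. 2 with empty boundary). [cite: Evans2010, App. C.2 Thm. 2] -/
theorem integral_mul_inner_gradient_self_eq_zero {u : UnitAddTorus d → EuclideanSpace ℝ d}
    {θ : UnitAddTorus d → ℝ} (hu : FunctionSpaces.Torus.IsSmooth u) (hdiv : FunctionSpaces.Torus.IsDivFree u)
    (hθ : FunctionSpaces.Torus.IsSmooth θ) :
    ∫ x, θ x * ⟪u x, FunctionSpaces.Torus.gradient θ x⟫_ℝ = 0 := by
  have h := integral_mul_inner_gradient_add_eq_zero hu hdiv hθ hθ
  have hcomm : (fun x => ⟪u x, FunctionSpaces.Torus.gradient θ x⟫_ℝ * θ x) =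
      fun x => θ x * ⟪u x, FunctionSpaces.Torus.gradient θ x⟫_ℝ := funext fun x => mul_comm _ _
  rw [hcomm] at h
  linarith

/-- `∫ Δθ = 0` on the torus for smooth `θ` (`Δθ = ∑ᵢ ∂ᵢ∂ᵢθ` and `∫ ∂ᵢ(·) = 0`; Evans 2010,
App. C.2, Thm. 1 with empty boundary). [cite: Evans2010, App. C.2 Thm. 1] -/
theorem integral_laplacian_eq_zero_of_isSmooth {θ : UnitAddTorus d → ℝ} (hθ : FunctionSpaces.Torus.IsSmooth θ) :
    ∫ x, FunctionSpaces.Torus.laplacian θ x = 0 := by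
  have h : (fun x => FunctionSpaces.Torus.laplacian θ x) =
      fun x => ∑ i, FunctionSpaces.Torus.partialDeriv i (FunctionSpaces.Torus.partialDeriv i θ) x :=
    funext fun x => FunctionSpaces.Torus.laplacian_eq_sum_partialDeriv_partialDeriv hθ x
  rw [h, integral_finsetSum _ fun i _ => ((hθ.partialDeriv i).partialDeriv i).integrable]
  exact Finset.sum_eq_zero fun i _ =>
    FunctionSpaces.Torus.integral_partialDeriv_eq_zero_holds (hθ.partialDeriv i) i

/-- `∫ ⟪u, ∇θ⟫ = 0` for a smooth divergence-free `u` and smooth `θ` (Evans 2010, App. C.2,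
Thm. 2 with empty boundary and `div u = 0`). [cite: Evans2010, App. C.2 Thm. 2] -/
theorem integral_inner_gradient_eq_zero_of_isDivFree' {u : UnitAddTorus d → EuclideanSpace ℝ d}
    {θ : UnitAddTorus d → ℝ} (hu : FunctionSpaces.Torus.IsSmooth u) (hdiv : FunctionSpaces.Torus.IsDivFree u)
    (hθ : FunctionSpaces.Torus.IsSmooth θ) :
    ∫ x, ⟪u x, FunctionSpaces.Torus.gradient θ x⟫_ℝ = 0 := by
  have h : (fun x => ⟪u x, FunctionSpaces.Torus.gradient θ x⟫_ℝ) =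
      fun x => ⟪FunctionSpaces.Torus.gradient θ x, u x⟫_ℝ := funext fun x => real_inner_comm _ _
  rw [h]
  exact FunctionSpaces.Torus.integral_inner_gradient_eq_zero_of_isDivFree hu hθ hdiv

/-! ## Restriction of classical solutions to sub-intervals -/

namespace IsClassicalScalarTransportOn

variable {S S' : Set ℝ} {κ : ℝ} {u : ℝ → UnitAddTorus d → EuclideanSpace ℝ d}
  {θ : ℝ → UnitAddTorus d → ℝ}

/-- **Restriction of the time set.** A classical solution on `S` is a classical solution on any
subset `S' ⊆ S` of unique differentiability (e.g. a non-trivial sub-interval): the one-sided time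
derivatives within `S` and within `S'` agree on `S'` (the slice `τ ↦ θ τ x` is differentiable
within `S`, `Torus.IsSmoothSpaceTimeOn.hasDerivWithinAt_slice`, and `derivWithin` is determined
by unique differentiability). [folklore] -/
theorem restrict (h : IsClassicalScalarTransportOn S κ u θ) (hS' : S' ⊆ S)
    (hU : UniqueDiffOn ℝ S') : IsClassicalScalarTransportOn S' κ u θ where
  smooth_velocity := h.smooth_velocity.mono hS'
  smooth_scalar := h.smooth_scalar.mono hS'
  transport t ht x := by
    have hd : FunctionSpaces.Torus.timeDerivWithin S' θ t x = FunctionSpaces.Torus.timeDerivWithin S θ t x :=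
      ((h.smooth_scalar.hasDerivWithinAt_slice (hS' ht) x).mono hS').derivWithin (hU t ht)
    rw [hd]
    exact h.transport t (hS' ht) x
  divFree t ht := h.divFree t (hS' ht)

/-- Restriction to a non-trivial closed interval `[a, b] ⊆ S`, `a < b`. [folklore] -/
theorem restrict_Icc (h : IsClassicalScalarTransportOn S κ u θ) {a b : ℝ} (hab : a < b)
    (hS : Icc a b ⊆ S) : IsClassicalScalarTransportOn (Icc a b) κ u θ :=
  h.restrict hS (uniqueDiffOn_Icc hab)

/-! ## The balance laws -/

/-- The scalar enstrophy `t ↦ ‖∇θ(t)‖²_{L²}` of a classical solution on a convex time set is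
continuous in time (the integrand `‖∇θ‖² = ⟪∇θ, ∇θ⟫` is jointly smooth; continuity of space
integrals of jointly smooth fields). At an isolated point there is nothing to prove. [folklore] -/
theorem continuousOn_scalarGradNormSq (h : IsClassicalScalarTransportOn S κ u θ) (hS : Convex ℝ S)
    (hU : UniqueDiffOn ℝ S) : ContinuousOn (fun t => scalarGradNormSq (θ t)) S := by
  have hg := h.smooth_scalar.gradient hU
  have hφ : FunctionSpaces.Torus.IsSmoothSpaceTimeOn S
      (fun t x => ⟪FunctionSpaces.Torus.gradient (θ t) x, FunctionSpaces.Torus.gradient (θ t) x⟫_ℝ) := hg.inner hg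
  have hc := hφ.continuousOn_integral hS
  refine hc.congr fun t _ => ?_
  simp only [scalarGradNormSq, real_inner_self_eq_norm_sq]

/-- **Discharge** of `IsClassicalScalarTransportOn.hasDerivWithinAt_scalarMean` (`PassiveScalar`):
conservation of the mean, `d/dt ∫ θ(t) = 0` within a convex time set (integrate the equation over
`T^d`: `∫ ⟪u, ∇θ⟫ = 0` by incompressibility and `∫ Δθ = 0`; DEIJ 2022, §1). [cite: DEIJ2022, §1] -/
theorem hasDerivWithinAt_scalarMean_holds :
    hasDerivWithinAt_scalarMean (S := S) (κ := κ) (u := u) (θ := θ) := by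
  intro h hS t ht
  by_cases hacc : AccPt t (𝓟 S)
  swap
  · exact HasFDerivWithinAt.of_not_accPt hacc
  have hU : UniqueDiffOn ℝ S :=
    uniqueDiffOn_convex hS (FunctionSpaces.Torus.interior_nonempty_of_convex_of_accPt hS ht hacc)
  have hθs := h.smooth_scalar
  have hθt : FunctionSpaces.Torus.IsSmooth (θ t) := hθs.isSmooth_slice ht
  have hut : FunctionSpaces.Torus.IsSmooth (u t) := h.smooth_velocity.isSmooth_slice ht
  have hE := hθs.hasDerivWithinAt_integral hS ht
  have hval : ∫ x, FunctionSpaces.Torus.timeDerivWithin S θ t x = 0 := by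
    have hpt : (fun x => FunctionSpaces.Torus.timeDerivWithin S θ t x) =
        fun x => κ * FunctionSpaces.Torus.laplacian (θ t) x - ⟪u t x, FunctionSpaces.Torus.gradient (θ t) x⟫_ℝ := by
      funext x
      have := h.transport t ht x
      linarith
    have i1 : Integrable (fun x => κ * FunctionSpaces.Torus.laplacian (θ t) x) volume :=
      (continuous_const.mul hθt.laplacian.continuous).integrable_unitAddTorus
    rw [hpt, integral_sub i1 (hut.inner hθt.gradient).integrable, integral_const_mul,
      integral_laplacian_eq_zero_of_isSmooth hθt, integral_inner_gradient_eq_zero_of_isDivFree' hut (h.divFree t ht) hθt]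
    ring
  rw [hval] at hE
  exact hE

/-- **Discharge** of `IsClassicalScalarTransportOn.hasDerivWithinAt_scalarL2Sq` (`PassiveScalar`):
the `L²` balance `d/dt ‖θ(t)‖²_{L²} = -2κ‖∇θ(t)‖²_{L²}` within a convex time set (multiply the
equation by `θ` and integrate: `d/dt ∫ θ² = 2∫ θ ∂ₜθ = 2κ∫ θΔθ - 2∫ θ⟪u, ∇θ⟫ = -2κ∫‖∇θ‖²`;
DEIJ 2022, (1.2); Evans 2010, §7.1.2). At an isolated point of `S` the statement is vacuous. [cite: DEIJ2022, (1.2)] -/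
theorem hasDerivWithinAt_scalarL2Sq_holds :
    hasDerivWithinAt_scalarL2Sq (S := S) (κ := κ) (u := u) (θ := θ) := by
  intro h hS t ht
  by_cases hacc : AccPt t (𝓟 S)
  swap
  · exact HasFDerivWithinAt.of_not_accPt hacc
  have hU : UniqueDiffOn ℝ S :=
    uniqueDiffOn_convex hS (FunctionSpaces.Torus.interior_nonempty_of_convex_of_accPt hS ht hacc)
  have hθs := h.smooth_scalar
  have hθt : FunctionSpaces.Torus.IsSmooth (θ t) := hθs.isSmooth_slice ht
  have hut : FunctionSpaces.Torus.IsSmooth (u t) := h.smooth_velocity.isSmooth_slice ht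
  have hA : FunctionSpaces.Torus.IsSmooth (FunctionSpaces.Torus.timeDerivWithin S θ t) :=
    hθs.isSmooth_timeDerivWithin hU ht
  -- differentiate `∫ θ²` under the integral sign
  have hφ : FunctionSpaces.Torus.IsSmoothSpaceTimeOn S (fun s x => θ s x * θ s x) := hθs.mul hθs
  have hE := hφ.hasDerivWithinAt_integral hS ht
  have htd : ∀ x, FunctionSpaces.Torus.timeDerivWithin S (fun s x => θ s x * θ s x) t x =
      2 * (θ t x * FunctionSpaces.Torus.timeDerivWithin S θ t x) := by
    intro x
    have h2 : HasDerivWithinAt (fun τ => θ τ x * θ τ x)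
        (FunctionSpaces.Torus.timeDerivWithin S θ t x * θ t x +
          θ t x * FunctionSpaces.Torus.timeDerivWithin S θ t x) S t :=
      (hθs.hasDerivWithinAt_slice ht x).mul (hθs.hasDerivWithinAt_slice ht x)
    rw [FunctionSpaces.Torus.timeDerivWithin, h2.derivWithin (hU t ht)]
    ring
  have hfun : (fun s => scalarL2Sq (θ s)) = fun s => ∫ x, θ s x * θ s x := by
    funext s
    simp only [scalarL2Sq, sq]
  rw [hfun]
  refine hE.congr_deriv ?_
  -- evaluate `∫ 2 θ ∂ₜθ` with the equation and the two integrations by parts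
  have hpt : (fun x => FunctionSpaces.Torus.timeDerivWithin S (fun s x => θ s x * θ s x) t x) =
      fun x => 2 * (κ * (θ t x * FunctionSpaces.Torus.laplacian (θ t) x) -
        θ t x * ⟪u t x, FunctionSpaces.Torus.gradient (θ t) x⟫_ℝ) := by
    funext x
    rw [htd x]
    have := h.transport t ht x
    have hre : FunctionSpaces.Torus.timeDerivWithin S θ t x =
        κ * FunctionSpaces.Torus.laplacian (θ t) x - ⟪u t x, FunctionSpaces.Torus.gradient (θ t) x⟫_ℝ := by linarith
    rw [hre]
    ring
  have i1 : Integrable (fun x => θ t x * FunctionSpaces.Torus.laplacian (θ t) x) volume :=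
    (hθt.smul' hθt.laplacian).integrable
  have i2 : Integrable (fun x => θ t x * ⟪u t x, FunctionSpaces.Torus.gradient (θ t) x⟫_ℝ) volume :=
    (hθt.smul' (hut.inner hθt.gradient)).integrable
  rw [hpt, integral_const_mul, integral_sub (i1.const_mul κ) i2, integral_const_mul,
    integral_mul_laplacian_self_eq_neg_scalarGradNormSq hθt,
    integral_mul_inner_gradient_self_eq_zero hut (h.divFree t ht) hθt]
  ring

/-- **Discharge** of `IsClassicalScalarTransportOn.hasDerivWithinAt_scalarVariance`
(`PassiveScalar`): `d/dt Var θ(t) = -2κ‖∇θ(t)‖²_{L²}` within a convex time set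
(`Var θ = ‖θ‖² - (∫ θ)²`, the `L²` balance and conservation of the mean; DEIJ 2022, (1.2)). [cite: DEIJ2022, (1.2)] -/
theorem hasDerivWithinAt_scalarVariance_holds :
    hasDerivWithinAt_scalarVariance (S := S) (κ := κ) (u := u) (θ := θ) := by
  intro h hS t ht
  have h1 := hasDerivWithinAt_scalarL2Sq_holds h hS ht
  have h2 := hasDerivWithinAt_scalarMean_holds h hS ht
  have h3 : HasDerivWithinAt (fun s => scalarL2Sq (θ s) - scalarMean (θ s) ^ 2)
      (-(2 * κ) * scalarGradNormSq (θ t) - ((2 : ℕ) : ℝ) * scalarMean (θ t) ^ (2 - 1) * 0) S t :=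
    h1.sub (h2.pow 2)
  rw [mul_zero, sub_zero] at h3
  refine h3.congr (fun s hs => ?_) ?_
  · rw [scalarL2Sq_eq_scalarVariance_add_sq ((h.smooth_scalar.isSmooth_slice hs).memLp 2)]
    ring
  · rw [scalarL2Sq_eq_scalarVariance_add_sq ((h.smooth_scalar.isSmooth_slice ht).memLp 2)]
    ring

/-- **Discharge** of `IsClassicalScalarTransportOn.scalarL2Sq_add_scalarDissipation`
(`PassiveScalar`): the integrated `L²` balance `‖θ(b)‖²_{L²} + 2κ∫ₐᵇ‖∇θ(t)‖²_{L²} dt = ‖θ(a)‖²_{L²}`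
for a classical solution on `S ⊇ [a, b]` (restrict to `[a, b]`, where the balance
`hasDerivWithinAt_scalarL2Sq` holds with a continuous right-hand side, and apply the fundamental
theorem of calculus; DEIJ 2022, (1.2)–(1.3); this is "the energy equality for `θ^m`" of
Cheskidov 2023, §4). [cite: DEIJ2022, (1.2)–(1.3)] -/
theorem scalarL2Sq_add_scalarDissipation_holds :
    scalarL2Sq_add_scalarDissipation (S := S) (κ := κ) (u := u) (θ := θ) := by
  intro h a b hab hS
  rcases eq_or_lt_of_le hab with rfl | hab'
  · simp [scalarDissipation]
  have h' := h.restrict_Icc hab' hS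
  have hconv : Convex ℝ (Icc a b) := convex_Icc a b
  have hU : UniqueDiffOn ℝ (Icc a b) := uniqueDiffOn_Icc hab'
  set D : ℝ → ℝ := fun τ => -(2 * κ) * scalarGradNormSq (θ τ) with hD
  have hderiv : ∀ τ ∈ Icc a b, HasDerivWithinAt (fun σ => scalarL2Sq (θ σ)) (D τ) (Icc a b) τ :=
    fun τ hτ => hasDerivWithinAt_scalarL2Sq_holds h' hconv hτ
  have hGc : ContinuousOn (fun τ => scalarGradNormSq (θ τ)) (Icc a b) :=
    h'.continuousOn_scalarGradNormSq hconv hU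
  have hGi : IntervalIntegrable (fun τ => scalarGradNormSq (θ τ)) volume a b :=
    (hGc.mono (uIcc_of_le hab).subset).intervalIntegrable
  have hFTC : ∫ τ in a..b, D τ = scalarL2Sq (θ b) - scalarL2Sq (θ a) :=
    intervalIntegral.integral_eq_sub_of_hasDerivAt_of_le hab
      (fun τ hτ => (hderiv τ hτ).continuousWithinAt)
      (fun τ hτ => (hderiv τ (Ioo_subset_Icc_self hτ)).hasDerivAt (Icc_mem_nhds hτ.1 hτ.2))
      (hGi.const_mul _)
  rw [intervalIntegral.integral_const_mul] at hFTC
  simp only [scalarDissipation]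
  linarith

/-- The `L²` norm of a classical solution with `κ ≥ 0` is non-increasing on every interval
`[a, b] ⊆ S` (the dissipation `2κ∫‖∇θ‖²` is nonnegative; DEIJ 2022, (1.3); Cheskidov 2023, §4:
"`‖θ^m(t_{m+1})‖² ≤ ‖θ^m(0)‖² = 1`"). [cite: DEIJ2022, (1.3)] -/
theorem antitoneOn_scalarL2Sq (h : IsClassicalScalarTransportOn S κ u θ) (hκ : 0 ≤ κ) {a b : ℝ}
    (hS : Icc a b ⊆ S) : AntitoneOn (fun t => scalarL2Sq (θ t)) (Icc a b) := by
  intro s hs t ht hst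
  have hsub : Icc s t ⊆ S := (Icc_subset_Icc hs.1 ht.2).trans hS
  have hid := scalarL2Sq_add_scalarDissipation_holds h hst hsub
  have hnn : 0 ≤ scalarDissipation κ θ s t := scalarDissipation_nonneg hκ θ hst
  dsimp only
  linarith

/-- Energy bound for the dissipation: `2κ∫ₐᵇ‖∇θ‖² ≤ ‖θ(a)‖²_{L²}` on `[a, b] ⊆ S`
(Cheskidov 2023, §4, first display: "`2ν_m∫₀¹‖∇θ^m‖² ≤ ‖θ^m(0)‖² = 1`"). [cite: Cheskidov2023, §4] -/
theorem two_mul_scalarDissipation_le (h : IsClassicalScalarTransportOn S κ u θ) {a b : ℝ} (hab : a ≤ b)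
    (hS : Icc a b ⊆ S) : 2 * scalarDissipation κ θ a b ≤ scalarL2Sq (θ a) := by
  have hid := scalarL2Sq_add_scalarDissipation_holds h hab hS
  linarith [scalarL2Sq_nonneg (θ b)]

/-- Conservation of the mean in integrated form: `∫ θ(t) = ∫ θ(a)` for `t ∈ [a, b] ⊆ S`; in
particular zero mean is propagated (Cheskidov 2023, §3–§4: the scalars `θ^m(t)` have zero mean
because `ρ_in` has). [folklore] -/
theorem scalarMean_eq (h : IsClassicalScalarTransportOn S κ u θ) {a b : ℝ} (hS : Icc a b ⊆ S)
    {t : ℝ} (ht : t ∈ Icc a b) : scalarMean (θ t) = scalarMean (θ a) := by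
  rcases eq_or_lt_of_le ht.1 with rfl | hat
  · rfl
  have hab : a < b := hat.trans_le ht.2
  have h' := h.restrict_Icc hab hS
  have hconv : Convex ℝ (Icc a b) := convex_Icc a b
  have hderiv : ∀ τ ∈ Icc a b, HasDerivWithinAt (fun σ => scalarMean (θ σ)) 0 (Icc a b) τ :=
    fun τ hτ => hasDerivWithinAt_scalarMean_holds h' hconv hτ
  have hta : Icc a t ⊆ Icc a b := Icc_subset_Icc le_rfl ht.2
  have hFTC : ∫ τ in a..t, (0 : ℝ) = scalarMean (θ t) - scalarMean (θ a) :=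
    intervalIntegral.integral_eq_sub_of_hasDerivAt_of_le ht.1
      (fun τ hτ => ((hderiv τ (hta hτ)).continuousWithinAt).mono hta)
      (fun τ hτ => (hderiv τ (hta (Ioo_subset_Icc_self hτ))).hasDerivAt
        (Icc_mem_nhds hτ.1 (hτ.2.trans_le ht.2)))
      intervalIntegrable_const
  simp only [intervalIntegral.integral_zero] at hFTC
  linarith

/-- Zero mean is propagated by classical solutions: if `θ(a)` has zero mean then so has `θ(t)`
for every `t ∈ [a, b] ⊆ S`. [folklore] -/
theorem hasZeroMean (h : IsClassicalScalarTransportOn S κ u θ) {a b : ℝ} (hS : Icc a b ⊆ S)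
    (h0 : FunctionSpaces.Torus.HasZeroMean (θ a)) {t : ℝ} (ht : t ∈ Icc a b) :
    FunctionSpaces.Torus.HasZeroMean (θ t) := by
  have := h.scalarMean_eq hS ht
  rw [scalarMean, scalarMean] at this
  rw [FunctionSpaces.Torus.HasZeroMean, this]
  exact h0

end IsClassicalScalarTransportOn

end Torus

end Literature.Analysis.FluidPDE

end
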